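import Summits.KontsevichZagierPeriods.KontsevichZagierPeriods.Theses.HyperbolicBloch
import Summits.KontsevichZagierPeriods.KontsevichZagierPeriods.Theorems.HyperbolicBlochOffTetraSectorKernelBridge

/-!
# `OffTetraSectorKernel` (stmt-KontsevichZagierPeriods-10557, route HyperbolicBloch) — line `flat-shadow`, skeleton v3 (self-contained copy: the transfer certificates of `…Glue.lean` (p92312) are reproduced below so that this workfile elaborates against `…Bridge.lean` alone)

Everything of the line has LANDED except its honest remainder:

* Stage 1 (`stub_invert` p80648, `stub_descend` p82643): `tetraFlatten : [T(z), t⁻³] ∼ [Δ(0,1,z), b/(2 pw)]`.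
* Stage 2, the Milnor bridge (`stub_fanCell` p86369, `stub_vCell` p88016, `stub_rayScale` p89040, `stub_cellAlgebra`
  p85325, `stub_cellScale` p89575, `stub_mobiusCell` p85556; composed in `…Theorems/HyperbolicBlochOffTetraSectorKernelBridge.lean`):
  `rayMeetsShadow`, `milnorBridge : KZ.Equivalent (KZ.idealTetrahedronRep z hz him) (KZ.rayDilogRep z.re z.im _ _)`.
* Transfer certificates (`…Theorems/HyperbolicBlochOffTetraSectorKernelGlue.lean`): `offTetraSectorKernel_iff_offFlat`,
  `offTetraSectorKernel_iff_offRay` (crux ⇔ its form with Zagier's RAY oracle), `offTetraSectorKernel_on_envelope`.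
* `stub_offRay` — the REMAINDER: the kernel form of Conjecture 1 with the ray oracle adjoined; crux-EQUIVALENT by
  `offTetraSectorKernel_iff_offRay`, hence summit-strength (`Cruxes/OffTetraSectorKernel/Disproof.lean` §1: `of_summit`,
  `iff_summit_of_sector`); implied by the OPEN `Literature.NumberTheory.Transcendental.KZKernelConjecture`
  (`AddSubgroup.mem_sup_left`); drefute/worker verdicts: stub-blocked on that conjecture. Not a proof target of this line.

Composition: `OffTetraSectorKernel_of := offTetraSectorKernel_iff_offRay.mpr stub_offRay`.
-/

noncomputable section

open Set MeasureTheory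
open Literature.NumberTheory.Transcendental

namespace Summit.KontsevichZagierPeriods.HyperbolicBloch.OffTetraSectorKernel

/-- Generator exchange: if every generator of `A` is congruent modulo `relations` to an element of
`closure B`, then `relations ⊔ closure A ≤ relations ⊔ closure B`. [folklore] -/
theorem sup_closure_le_of_exchange {A B : Set KZ.FormalRep}
    (h : ∀ a ∈ A, ∃ b ∈ AddSubgroup.closure B, a - b ∈ KZ.relations) :
    KZ.relations ⊔ AddSubgroup.closure A ≤ KZ.relations ⊔ AddSubgroup.closure B := by
  refine sup_le le_sup_left ((AddSubgroup.closure_le _).mpr fun a ha => ?_)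
  obtain ⟨b, hb, hab⟩ := h a ha
  have : a = (a - b) + b := by abel
  rw [this]
  exact add_mem (AddSubgroup.mem_sup_left hab) (AddSubgroup.mem_sup_right hb)

/-- Oracle exchange: two families that are generatorwise KZ-equivalent on a set of parameters have
exchangeable zero-sum combinations there. [cite: KontsevichZagier2001, §1.2] -/
theorem oracle_exchange {m m' : ℕ} (P : ℂ → Prop) (ρ : ℂ → KZ.IntegralRep m)
    (σ : ℂ → KZ.IntegralRep m') (hE : ∀ z, P z → KZ.Equivalent (ρ z) (σ z))
    (k : ℕ) (z : Fin k → ℂ) (n : Fin k → ℤ) (hz : ∀ i, P (z i))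
    (hsum : ∑ i, (n i : ℝ) * (ρ (z i)).value = 0) :
    (∑ i, n i • KZ.of (ρ (z i))) - (∑ i, n i • KZ.of (σ (z i))) ∈ KZ.relations ∧
      ∑ i, (n i : ℝ) * (σ (z i)).value = 0 := by
  have hdiff : ∀ i, KZ.of (ρ (z i)) - KZ.of (σ (z i)) ∈ KZ.relations := fun i => hE (z i) (hz i)
  have hval : ∀ i, (σ (z i)).value = (ρ (z i)).value := fun i =>
    (KZ.Equivalent.value_eq_holds (hdiff i)).symm
  refine ⟨?_, by simpa [hval] using hsum⟩
  rw [← Finset.sum_sub_distrib]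
  refine sum_mem fun i _ => ?_
  rw [← smul_sub]
  exact zsmul_mem (hdiff i) _

/-- An admissible tetrahedral family exists: `KZ.idealTetrahedronRep z` on `ℚ̄ ∩ ℍ⁺`, the empty representation
elsewhere. [cite: KontsevichZagier2001, §1.1] -/
theorem exists_tetraFamily : ∃ ρ : ℂ → KZ.IntegralRep 3, ∀ z, IsAlgebraic ℚ z → 0 < z.im →
    (ρ z).domain = idealTetrahedron z ∧ EqOn (ρ z).integrand (fun p => 1 / p 2 ^ 3) (idealTetrahedron z) := by
  classical
  refine ⟨fun z => if h : IsAlgebraic ℚ z ∧ 0 < z.im then KZ.idealTetrahedronRep z h.1 h.2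
    else KZ.IntegralRep.empty 3, fun z hz him => ?_⟩
  have h : IsAlgebraic ℚ z ∧ 0 < z.im := ⟨hz, him⟩
  dsimp only
  rw [dif_pos h]
  exact ⟨rfl, fun _ _ => rfl⟩

/-- **The crux is invariant under flattening its oracle** (`Off ↔ Off♭`). [cite: KontsevichZagier2001, §1.2] -/
theorem offTetraSectorKernel_iff_offFlat : Summit.KontsevichZagierPeriods.KontsevichZagierPeriods.Theses.HyperbolicBloch.OffTetraSectorKernel ↔ (∀ c : Literature.NumberTheory.Transcendental.KZ.FormalRep, Literature.NumberTheory.Transcendental.KZ.eval c = 0 → c ∈ Literature.NumberTheory.Transcendental.KZ.relations ⊔ AddSubgroup.closure {d : Literature.NumberTheory.Transcendental.KZ.FormalRep | ∃ σ : ℂ → Literature.NumberTheory.Transcendental.KZ.IntegralRep 2, (∀ z, IsAlgebraic ℚ z → 0 < z.im → (σ z).domain = {q | 0 < q 1 ∧ z.re * q 1 < z.im * q 0 ∧ z.im * (q 0 - 1) < (z.re - 1) * q 1} ∧ Set.EqOn (σ z).integrand (fun q => z.im / (2 * (z.im * (q 0 - q 0 ^ 2 - q 1 ^ 2) + (Complex.normSq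 z - z.re) * q 1))) {q | 0 < q 1 ∧ z.re * q 1 < z.im * q 0 ∧ z.im * (q 0 - 1) < (z.re - 1) * q 1}) ∧ ∃ (k : ℕ) (z : Fin k → ℂ) (n : Fin k → ℤ), (∀ i, IsAlgebraic ℚ (z i)) ∧ (∀ i, 0 < (z i).im) ∧ ∑ i, (n i : ℝ) * (σ (z i)).value = 0 ∧ d = ∑ i, n i • Literature.NumberTheory.Transcendental.KZ.of (σ (z i))}) := by
  obtain ⟨ρ₀, hρ₀⟩ := exists_tetraFamily
  obtain ⟨σ₀, hσ₀⟩ := exists_flatFamily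
  constructor
  · intro hO c hc
    refine sup_closure_le_of_exchange ?_ (hO idealTetrahedron (fun _ => rfl) c hc)
    rintro a ⟨ρ, hρ, k, z, n, halg, him, hsum, rfl⟩
    have hE : ∀ w, (IsAlgebraic ℚ w ∧ 0 < w.im) → KZ.Equivalent (ρ w) (σ₀ w) := fun w hw =>
      tetraFlatten w hw.1 hw.2 (ρ w) (σ₀ w) (hρ w hw.1 hw.2).1
        (by rw [(hρ w hw.1 hw.2).1]; exact (hρ w hw.1 hw.2).2)
        (hσ₀ w hw.1 hw.2).1 (by rw [(hσ₀ w hw.1 hw.2).1]; exact (hσ₀ w hw.1 hw.2).2)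
    obtain ⟨hrel, hsum'⟩ := oracle_exchange (fun w => IsAlgebraic ℚ w ∧ 0 < w.im) ρ σ₀ hE k z n
      (fun i => ⟨halg i, him i⟩) hsum
    exact ⟨_, AddSubgroup.subset_closure ⟨σ₀, hσ₀, k, z, n, halg, him, hsum', rfl⟩, hrel⟩
  · intro hflat T hT c hc
    have hTe : T = idealTetrahedron := funext fun z => (hT z).trans rfl
    subst hTe
    refine sup_closure_le_of_exchange ?_ (hflat c hc)
    rintro a ⟨σ, hσ, k, z, n, halg, him, hsum, rfl⟩
    have hE : ∀ w, (IsAlgebraic ℚ w ∧ 0 < w.im) → KZ.Equivalent (σ w) (ρ₀ w) := fun w hw =>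
      (tetraFlatten w hw.1 hw.2 (ρ₀ w) (σ w) (hρ₀ w hw.1 hw.2).1
        (by rw [(hρ₀ w hw.1 hw.2).1]; exact (hρ₀ w hw.1 hw.2).2)
        (hσ w hw.1 hw.2).1 (by rw [(hσ w hw.1 hw.2).1]; exact (hσ w hw.1 hw.2).2)).symm
    obtain ⟨hrel, hsum'⟩ := oracle_exchange (fun w => IsAlgebraic ℚ w ∧ 0 < w.im) σ ρ₀ hE k z n
      (fun i => ⟨halg i, him i⟩) hsum
    exact ⟨_, AddSubgroup.subset_closure ⟨ρ₀, hρ₀, k, z, n, halg, him, hsum', rfl⟩, hrel⟩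

/-- **The crux is its form with Zagier's RAY oracle** (`Off ↔ OffRay`; transfer certificate of the line's remainder
`stub_offRay`): exchange flat generators for ray generators and back along `rayMeetsShadow`.
[cite: Zagier2007Dilogarithm, Ch. I §3] -/
theorem offTetraSectorKernel_iff_offRay : Summit.KontsevichZagierPeriods.KontsevichZagierPeriods.Theses.HyperbolicBloch.OffTetraSectorKernel ↔ (∀ c : Literature.NumberTheory.Transcendental.KZ.FormalRep, Literature.NumberTheory.Transcendental.KZ.eval c = 0 → c ∈ Literature.NumberTheory.Transcendental.KZ.relations ⊔ AddSubgroup.closure {d : Literature.NumberTheory.Transcendental.KZ.FormalRep | ∃ ρ : ℂ → Literature.NumberTheory.Transcendental.KZ.IntegralRep 2, (∀ z, IsAlgebraic ℚ z → 0 < z.im → (ρ z).domain = Literature.NumberTheory.Transcendental.KZ.rayDilogDomain z.re z.im ∧ Set.EqOn (ρ z).integrand (Literature.NumberTheory.Transcendental.KZ.rayDilogIntegrand z.re z.im) (Literature.NumberTheory.Transcendental.KZ.rayDilogDomain z.re z.im)) ∧ ∃ (k : ℕ) (z : Fin k → ℂ) (n : Fin k → ℤ), (∀ i, IsAlgebraic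 ℚ (z i)) ∧ (∀ i, 0 < (z i).im) ∧ ∑ i, (n i : ℝ) * (ρ (z i)).value = 0 ∧ d = ∑ i, n i • Literature.NumberTheory.Transcendental.KZ.of (ρ (z i))}) := by
  rw [offTetraSectorKernel_iff_offFlat]
  obtain ⟨σ₀, hσ₀⟩ := exists_flatFamily
  obtain ⟨τ₀, hτ₀⟩ := exists_rayFamily
  constructor
  · intro hflat c hc
    refine sup_closure_le_of_exchange ?_ (hflat c hc)
    rintro a ⟨σ, hσ, k, z, n, halg, him, hsum, rfl⟩
    have hE : ∀ w, (IsAlgebraic ℚ w ∧ 0 < w.im) → KZ.Equivalent (σ w) (τ₀ w) := fun w hw =>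
      rayMeetsShadow w hw.1 hw.2 (σ w) (τ₀ w) (hσ w hw.1 hw.2).1
        (by rw [(hσ w hw.1 hw.2).1]; exact (hσ w hw.1 hw.2).2)
        (hτ₀ w hw.1 hw.2).1 (by rw [(hτ₀ w hw.1 hw.2).1]; exact (hτ₀ w hw.1 hw.2).2)
    obtain ⟨hrel, hsum'⟩ := oracle_exchange (fun w => IsAlgebraic ℚ w ∧ 0 < w.im) σ τ₀ hE k z n
      (fun i => ⟨halg i, him i⟩) hsum
    exact ⟨_, AddSubgroup.subset_closure ⟨τ₀, hτ₀, k, z, n, halg, him, hsum', rfl⟩, hrel⟩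
  · intro hray c hc
    refine sup_closure_le_of_exchange ?_ (hray c hc)
    rintro a ⟨ρ, hρ, k, z, n, halg, him, hsum, rfl⟩
    have hE : ∀ w, (IsAlgebraic ℚ w ∧ 0 < w.im) → KZ.Equivalent (ρ w) (σ₀ w) := fun w hw =>
      (rayMeetsShadow w hw.1 hw.2 (σ₀ w) (ρ w) (hσ₀ w hw.1 hw.2).1
        (by rw [(hσ₀ w hw.1 hw.2).1]; exact (hσ₀ w hw.1 hw.2).2)
        (hρ w hw.1 hw.2).1 (by rw [(hρ w hw.1 hw.2).1]; exact (hρ w hw.1 hw.2).2)).symm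
    obtain ⟨hrel, hsum'⟩ := oracle_exchange (fun w => IsAlgebraic ℚ w ∧ 0 < w.im) ρ σ₀ hE k z n
      (fun i => ⟨halg i, him i⟩) hsum
    exact ⟨_, AddSubgroup.subset_closure ⟨σ₀, hσ₀, k, z, n, halg, him, hsum', rfl⟩, hrel⟩

/-- **Envelope principle** (unconditional rung of the crux): for ANY admissible tetrahedral family `ρ₀` on the pinned
solids `T z`, every `c` with `eval c = 0` in the subgroup generated by the classes that are KZ-equivalent to a
tetrahedral combination over `ρ₀` lies in `relations ⊔ closure {tetrahedral value-relators}`.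
[cite: KontsevichZagier2001, §1.2] -/
theorem offTetraSectorKernel_on_envelope (T : ℂ → Set (Fin 3 → ℝ)) (ρ₀ : ℂ → KZ.IntegralRep 3)
    (hρ₀ : ∀ z, IsAlgebraic ℚ z → 0 < z.im →
      (ρ₀ z).domain = T z ∧ EqOn (ρ₀ z).integrand (fun p => 1 / p 2 ^ 3) (T z))
    {c : KZ.FormalRep}
    (hc : c ∈ AddSubgroup.closure {x : KZ.FormalRep | ∃ (k : ℕ) (z : Fin k → ℂ) (n : Fin k → ℤ),
      (∀ i, IsAlgebraic ℚ (z i)) ∧ (∀ i, 0 < (z i).im) ∧ x - ∑ i, n i • KZ.of (ρ₀ (z i)) ∈ KZ.relations})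
    (h0 : KZ.eval c = 0) :
    c ∈ KZ.relations ⊔ AddSubgroup.closure {d : KZ.FormalRep | ∃ ρ : ℂ → KZ.IntegralRep 3,
      (∀ z, IsAlgebraic ℚ z → 0 < z.im → (ρ z).domain = T z ∧
        EqOn (ρ z).integrand (fun p => 1 / p 2 ^ 3) (T z)) ∧
      ∃ (k : ℕ) (z : Fin k → ℂ) (n : Fin k → ℤ), (∀ i, IsAlgebraic ℚ (z i)) ∧ (∀ i, 0 < (z i).im) ∧
        ∑ i, (n i : ℝ) * (ρ (z i)).value = 0 ∧ d = ∑ i, n i • KZ.of (ρ (z i))} := by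
  have henv : ∃ (k : ℕ) (z : Fin k → ℂ) (n : Fin k → ℤ), (∀ i, IsAlgebraic ℚ (z i)) ∧
      (∀ i, 0 < (z i).im) ∧ c - ∑ i, n i • KZ.of (ρ₀ (z i)) ∈ KZ.relations := by
    refine AddSubgroup.closure_induction (p := fun x _ => ∃ (k : ℕ) (z : Fin k → ℂ) (n : Fin k → ℤ),
      (∀ i, IsAlgebraic ℚ (z i)) ∧ (∀ i, 0 < (z i).im) ∧ x - ∑ i, n i • KZ.of (ρ₀ (z i)) ∈ KZ.relations)
      (fun x hx => hx) ⟨0, Fin.elim0, Fin.elim0, fun i => i.elim0, fun i => i.elim0, by simp⟩ ?_ ?_ hc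
    · rintro x y _ _ ⟨k, z, n, hz, him, hx⟩ ⟨k', z', n', hz', him', hy⟩
      refine ⟨k + k', Fin.append z z', Fin.append n n', ?_, ?_, ?_⟩
      · intro i
        refine Fin.addCases (fun j => ?_) (fun j => ?_) i
        · simpa [Fin.append_left] using hz j
        · simpa [Fin.append_right] using hz' j
      · intro i
        refine Fin.addCases (fun j => ?_) (fun j => ?_) i
        · simpa [Fin.append_left] using him j
        · simpa [Fin.append_right] using him' j
      · rw [Fin.sum_univ_add]
        simp only [Fin.append_left, Fin.append_right]
        have : x + y - (∑ i : Fin k, n i • KZ.of (ρ₀ (z i)) + ∑ i : Fin k', n' i • KZ.of (ρ₀ (z' i))) =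
            (x - ∑ i, n i • KZ.of (ρ₀ (z i))) + (y - ∑ i, n' i • KZ.of (ρ₀ (z' i))) := by abel
        rw [this]
        exact add_mem hx hy
    · rintro x _ ⟨k, z, n, hz, him, hx⟩
      refine ⟨k, z, -n, hz, him, ?_⟩
      have : -x - ∑ i, (-n) i • KZ.of (ρ₀ (z i)) = -(x - ∑ i, n i • KZ.of (ρ₀ (z i))) := by
        simp [neg_smul, Finset.sum_neg_distrib]; abel
      rw [this]
      exact neg_mem hx
  obtain ⟨k, z, n, halg, him, hct⟩ := henv
  have ht0 : KZ.eval (∑ i, n i • KZ.of (ρ₀ (z i))) = 0 := by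
    have hker := KZ.relations_le_ker_eval_holds hct
    rw [AddMonoidHom.mem_ker, map_sub, h0, zero_sub, neg_eq_zero] at hker
    exact hker
  have hsum : ∑ i, (n i : ℝ) * (ρ₀ (z i)).value = 0 := by
    simpa [map_sum, map_zsmul, KZ.eval_of, zsmul_eq_mul] using ht0
  have : c = (c - ∑ i, n i • KZ.of (ρ₀ (z i))) + ∑ i, n i • KZ.of (ρ₀ (z i)) := by abel
  rw [this]
  exact add_mem (AddSubgroup.mem_sup_left hct)
    (AddSubgroup.mem_sup_right (AddSubgroup.subset_closure ⟨ρ₀, hρ₀, k, z, n, halg, him, hsum, rfl⟩))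


/-- STUB (the remainder `OffRay`, transfer `C⁺`, crux-equivalent and summit-strength — NOT a proof target of this
line): the kernel form of Conjecture 1 with the oracle of zero-sum ℤ-combinations of Zagier's ray representations
adjoined. [cite: KontsevichZagier2001, §1.2 Conjecture 1] -/
theorem stub_offRay : ∀ c : Literature.NumberTheory.Transcendental.KZ.FormalRep, Literature.NumberTheory.Transcendental.KZ.eval c = 0 → c ∈ Literature.NumberTheory.Transcendental.KZ.relations ⊔ AddSubgroup.closure {d : Literature.NumberTheory.Transcendental.KZ.FormalRep | ∃ ρ : ℂ → Literature.NumberTheory.Transcendental.KZ.IntegralRep 2, (∀ z, IsAlgebraic ℚ z → 0 < z.im → (ρ z).domain = Literature.NumberTheory.Transcendental.KZ.rayDilogDomain z.re z.im ∧ Set.EqOn (ρ z).integrand (Literature.NumberTheory.Transcendental.KZ.rayDilogIntegrand z.re z.im) (Literature.NumberTheory.Transcendental.KZ.rayDilogDomain z.re z.im)) ∧ ∃ (k : ℕ) (z : Fin k → ℂ) (n : Fin k → ℤ), (∀ i, IsAlgebraic ℚ (z i)) ∧ (∀ i, 0 < (z i).im) ∧ ∑ i, (n i : ℝ) * (ρ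 (z i)).value = 0 ∧ d = ∑ i, n i • Literature.NumberTheory.Transcendental.KZ.of (ρ (z i))} := by
  sorry

/-- **The line closes the crux modulo its remainder**: `OffRay ⇒ Off` by the transfer certificate.
[cite: KontsevichZagier2001, §1.2] -/
theorem OffTetraSectorKernel_of :
    Summit.KontsevichZagierPeriods.KontsevichZagierPeriods.Theses.HyperbolicBloch.OffTetraSectorKernel :=
  offTetraSectorKernel_iff_offRay.mpr stub_offRay

end Summit.KontsevichZagierPeriods.HyperbolicBloch.OffTetraSectorKernel

end
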